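import Summits.BirchSwinnertonDyer.BirchSwinnertonDyer.Theorems.ClassRecordThreeCornerAtThreeUpperShimuraSavedDGlue
import HarnessLib

/-!
# Crux `CornerAtThreeW` (item stmt-BirchSwinnertonDyer-21420; routes `ClassRecordThree` ∕ `KolyvaginRoadThree`; 19111 `CornerAtThree` aside), conjunct (U):
# the carrier-inert Shimura road's admissibility predicates WITHOUT THE (DEG) DATUM — the `3`-ANCHOR form — §1 of 3: DEFINITIONS and monotonicity
# (cell `bsd-stepL`, seat `bsd-stepL-corner3-p2` g12 = WIDTH-LEVER lane B; `--supports stmt-BirchSwinnertonDyer-21420 --as helper`)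

WHY. The line of record `Cruxes/CornerAtThreeW/Lines/inert.lean` (r12∕r13) sends a multi-carrier corner curve to the Shimura road iff `Three.CornerInertAdmissible W`
or `Three.CornerInertAdmissibleUpToOne W`; both carry a (DEG) datum — a multiplicative witness `ℓ₀` with `3 ∤ ord_{ℓ₀} Δ_min` or a Papikian–Rabinoff HALF `R ⊆ S`,
`#S = 2·#R`, of odd primes `q ≢ 1 (mod 3)` — consumed by the degree identity `ord₃ deg φ_N = ord₃ deg φ_{N⁺,N⁻} + Σ_{q∈S} ord₃ ord_q Δ_min`. On 2026-08-28 the critic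
idea-crit-14 (VERDICT #29) and the ideator bsd-idea-9 g4 observed, and the LEAD bsd-line-er5-p1 g1 landed (`EulerHalfPAnchor.PAnchor.padicValNat_delta_empty_eq_of_self_mem`),
that NO datum is needed when the BSD prime lies in `S` (Pasten's Lemma 6.18 AT `q = p`: `κ_D(p) ∣ p − 1`; Lemma 6.15 switching — the `p`-ANCHOR); width seat
bsd-line-er5-p1-w2 g2 packaged the telescope for ANY single anchor `a ∈ S` (`EulerHalfAnchorDegree.padicValNat_delta_empty_eq_of_oneAnchorDatum`); corner-p1 g17 ported
the `p`-anchor to lane B's image-free inert ∕ saved cores (p631574), lane B g12 the one-anchor to the split core (p632737). THIS FILE (§1 of 3; §2 roads + glue =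
`…UpperShimuraAnchorGlue`, §3 the tail lemma = `…UpperShimuraAnchorTail`):
* `Three.CornerInertAdmissibleAnchor W` — the Tamagawa SHAPE ∧ an even multiplicative `S` containing every split offender, the (DEG) clause CUT to «`S = ∅` or ONE
  anchor `a ∈ S` (`a = 2`, or `3 ∤ a − 1` — so `a = 3` qualifies —, or `3 ∤ ord_a Δ_min`)»;
* `Three.CornerInertAdmissibleUpToOneAnchor W` — the registered up-to-one predicate with the (DEG) clause DELETED (`3 ∈ S` is the anchor);
* `…Anchor_of_…` — both are WEAKER than the registered predicates (a witness outside `S` with a spare prime is moved inside), and the negations go the other way.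

HONEST FRAMING: two DEFINITIONS (decidable predicates on `W`; nothing asserted) and bookkeeping theorems; nothing here is a BSD class theorem; no census label moves (T7); 21420 ∕ 19111 NOT closed; BSD is proved for no curve. Credit: idea-crit-14 ∕
bsd-idea-9 g4 (the anchor), LEAD er5-p1 g1 and w2 g0–g2 (the telescopes, Lemma 6.18 in full), corner-p1 g17 (p-anchor inert ∕ saved cores), lane B g3–g12
(cores, glue, carrier dictionary), x11b3, tam3-p1, shim seats.
References (locators only): [cite: PastenShimura2024, §6.6, Prop. 6.13, Lemmas 6.15, 6.16 and 6.18 (arXiv v4 pp. 30–33)] [cite: PapikianRabinoff2016, Cor. 3.5]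
[cite: RibetTakahashi1997, Thm. 1] [cite: Jetchev2008, Thm. 1.1, Cor. 1.5] [cite: JetchevSkinnerWan2017, §7.4.2 (pp. 30–31)] [cite: CaiShuTian2014, Thm. 1.5]
[cite: SilvermanATAEC1994, Cor. IV.9.2 (d) and Table 4.1] [cite: SilvermanAEC2009, C.16].
-/

set_option autoImplicit false
set_option linter.dupNamespace false -- `Summit.BirchSwinnertonDyer.BirchSwinnertonDyer` (summit = problem), tree-wide

noncomputable section

open scoped Classical NumberField

open WeierstrassCurve NumberField IsDedekindDomain CongruenceSubgroup Literature.NumberTheory.EllipticCurves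
  Literature.NumberTheory.EllipticCurves.ModularForms Literature.NumberTheory.Automorphic
  Literature.NumberTheory.EllipticCurves.Rank1Residual Literature.NumberTheory.EllipticCurves.Rank1Residual.Typed
  Literature.NumberTheory.EllipticCurves.BarriosEtAl2025
  Summit.BirchSwinnertonDyer.Rank1Residual Summit.BirchSwinnertonDyer.Rank1Residual.X11b

/-! ### §1. The predicates without the (DEG) datum -/

namespace Summit.BirchSwinnertonDyer.Rank1Residual.X11b.Three

/-- **Admissibility of a corner curve for the carrier-inert road, ANCHOR form**: the Tamagawa SHAPE (every prime with `3 ∣ c_q` split multiplicative) and an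
even set `S` of multiplicative primes containing every split multiplicative `ℓ` with `3 ∣ ord_ℓ Δ_min`, which is EMPTY or contains ONE ANCHOR `a` — `a = 2`
(Pasten L6.18: `j₂ ∣ 2`), or `3 ∤ a − 1` (`j_a ∣ a − 1`; in particular `a = 3`, the `3`-anchor), or a witness `3 ∤ ord_a Δ_min` (L6.15∕6.16). The registered
`Three.CornerInertAdmissible` with its (DEG) datum (witness ∕ Papikian–Rabinoff HALF) cut to one anchor. A decidable predicate on `W`; nothing asserted.
[cite: PastenShimura2024, Lemmas 6.15, 6.16 and 6.18 (shape)] [cite: PapikianRabinoff2016, Cor. 3.5] -/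
def CornerInertAdmissibleAnchor (W : WeierstrassCurve ℚ) [W.IsElliptic] [W.IsGloballyMinimal] : Prop :=
  (∀ (q : ℕ) [Fact q.Prime], 3 ∣ (W.baseChange ℚ_[q]).localTamagawaNumber ℤ_[q] →
      W.HasSplitMultiplicativeReductionAtPrime q) ∧
  ∃ S : Finset ℕ, (∀ ℓ ∈ S, ∃ _ : Fact ℓ.Prime, Mult W ℓ) ∧ Even S.card ∧
    (∀ (ℓ : ℕ) [Fact ℓ.Prime], ℓ ∉ S → W.HasSplitMultiplicativeReductionAtPrime ℓ →
      ¬ 3 ∣ padicValInt ℓ W.minimalDiscriminantInt) ∧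
    (S = ∅ ∨ ∃ a ∈ S, a = 2 ∨ ¬ 3 ∣ a - 1 ∨ ¬ 3 ∣ padicValInt a W.minimalDiscriminantInt)

/-- **Admissibility UP TO ONE EXEMPTED PLACE, ANCHOR form**: ONE bad prime `q₁`, the Tamagawa SHAPE off `q₁`, an even set `S ∋ 3` of multiplicative primes,
`q₁ ∉ S`, containing every OTHER split multiplicative `ℓ` with `3 ∣ ord_ℓ Δ_min` — and NO (DEG) datum (`3 ∈ S` is the anchor). The registered
`Three.CornerInertAdmissibleUpToOne` with its datum clause deleted. A decidable predicate on `W`; nothing asserted.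
[cite: PastenShimura2024, Lemma 6.18 (shape)] [cite: Jetchev2008, Cor. 1.5 (the exempted place)] -/
def CornerInertAdmissibleUpToOneAnchor (W : WeierstrassCurve ℚ) [W.IsElliptic] [W.IsGloballyMinimal] : Prop :=
  ∃ (q₁ : ℕ) (_ : Fact q₁.Prime), ¬ W.HasGoodReductionAtPrime q₁ ∧
    (∀ (q : ℕ) [Fact q.Prime], q ≠ q₁ → 3 ∣ (W.baseChange ℚ_[q]).localTamagawaNumber ℤ_[q] →
      W.HasSplitMultiplicativeReductionAtPrime q) ∧
    ∃ S : Finset ℕ, (∀ ℓ ∈ S, ∃ _ : Fact ℓ.Prime, Mult W ℓ) ∧ Even S.card ∧ 3 ∈ S ∧ q₁ ∉ S ∧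
      (∀ (ℓ : ℕ) [Fact ℓ.Prime], ℓ ∉ S → ℓ ≠ q₁ → W.HasSplitMultiplicativeReductionAtPrime ℓ →
        ¬ 3 ∣ padicValInt ℓ W.minimalDiscriminantInt)

/-- `CornerInertAdmissible W → CornerInertAdmissibleAnchor W`: a witness inside `S` or a non-empty half gives an anchor; an empty half means `S = ∅`; a
witness `ℓ₀` OUTSIDE `S` with a second outside multiplicative prime `t` is moved INSIDE (`S ∪ {ℓ₀, t}`, still even, still containing the offenders).
[cite: PastenShimura2024, Lemmas 6.15, 6.16, 6.18] -/
theorem cornerInertAdmissibleAnchor_of_cornerInertAdmissible (W : WeierstrassCurve ℚ) [W.IsElliptic] [W.IsGloballyMinimal]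
    (h : CornerInertAdmissible W) : CornerInertAdmissibleAnchor W := by
  obtain ⟨hshape, S, hSmult, hSeven, hFC, hdeg⟩ := h
  rcases hdeg with ⟨ℓ₀, hℓ₀F, hm₀, hw₀, hwhere⟩ | ⟨R, hRS, hcard, hR⟩
  · by_cases hℓ₀S : ℓ₀ ∈ S
    · exact ⟨hshape, S, hSmult, hSeven, hFC, Or.inr ⟨ℓ₀, hℓ₀S, Or.inr (Or.inr hw₀)⟩⟩
    · rcases hwhere with h | ⟨t, htF, hmt, htS, htℓ⟩
      · exact absurd h hℓ₀S
      · -- move the witness `ℓ₀` and the spare multiplicative prime `t` INSIDE the inert set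
        have hℓ₀T : ℓ₀ ∉ insert t S := by
          rw [Finset.mem_insert]
          rintro (h | h)
          · exact htℓ h.symm
          · exact hℓ₀S h
        refine ⟨hshape, insert ℓ₀ (insert t S), ?_, ?_, ?_,
          Or.inr ⟨ℓ₀, Finset.mem_insert_self _ _, Or.inr (Or.inr hw₀)⟩⟩
        · intro ℓ hℓ
          rcases Finset.mem_insert.mp hℓ with rfl | hℓ
          · exact ⟨hℓ₀F, hm₀⟩
          rcases Finset.mem_insert.mp hℓ with rfl | hℓ
          · exact ⟨htF, hmt⟩
          · exact hSmult ℓ hℓ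
        · rw [Finset.card_insert_of_notMem hℓ₀T, Finset.card_insert_of_notMem htS]
          obtain ⟨n, hn⟩ := hSeven
          exact ⟨n + 1, by omega⟩
        · intro ℓ _ hℓS' hℓs
          exact hFC ℓ (fun h ↦ hℓS' (Finset.mem_insert_of_mem (Finset.mem_insert_of_mem h))) hℓs
  · by_cases hR0 : R = ∅
    · subst hR0
      have hS0 : S = ∅ := by
        rw [Finset.card_empty, mul_zero, Finset.card_eq_zero] at hcard
        exact hcard
      exact ⟨hshape, S, hSmult, hSeven, hFC, Or.inl hS0⟩
    · obtain ⟨a, ha⟩ := Finset.nonempty_iff_ne_empty.mpr hR0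
      exact ⟨hshape, S, hSmult, hSeven, hFC, Or.inr ⟨a, hRS ha, Or.inr (Or.inl (hR a ha).2)⟩⟩

/-- `CornerInertAdmissibleUpToOne W → CornerInertAdmissibleUpToOneAnchor W` (drop the datum). [cite: PastenShimura2024, Lemma 6.18] -/
theorem cornerInertAdmissibleUpToOneAnchor_of_cornerInertAdmissibleUpToOne (W : WeierstrassCurve ℚ) [W.IsElliptic]
    [W.IsGloballyMinimal] (h : CornerInertAdmissibleUpToOne W) : CornerInertAdmissibleUpToOneAnchor W := by
  obtain ⟨q₁, hq₁F, hbad₁, hshape, S, hSmult, hSeven, h3S, hq₁S, hFC, -⟩ := h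
  exact ⟨q₁, hq₁F, hbad₁, hshape, S, hSmult, hSeven, h3S, hq₁S, hFC⟩

/-- `¬ CornerInertAdmissibleAnchor W → ¬ CornerInertAdmissible W`: the registered residual binder ∕ tail stub serves the anchor glue a fortiori.
[cite: PastenShimura2024, Lemma 6.18] -/
theorem not_cornerInertAdmissible_of_not_anchor (W : WeierstrassCurve ℚ) [W.IsElliptic] [W.IsGloballyMinimal]
    (h : ¬ CornerInertAdmissibleAnchor W) : ¬ CornerInertAdmissible W :=
  fun h' ↦ h (cornerInertAdmissibleAnchor_of_cornerInertAdmissible W h')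

/-- `¬ CornerInertAdmissibleUpToOneAnchor W → ¬ CornerInertAdmissibleUpToOne W`. [cite: PastenShimura2024, Lemma 6.18] -/
theorem not_cornerInertAdmissibleUpToOne_of_not_anchor (W : WeierstrassCurve ℚ) [W.IsElliptic] [W.IsGloballyMinimal]
    (h : ¬ CornerInertAdmissibleUpToOneAnchor W) : ¬ CornerInertAdmissibleUpToOne W :=
  fun h' ↦ h (cornerInertAdmissibleUpToOneAnchor_of_cornerInertAdmissibleUpToOne W h')

end Summit.BirchSwinnertonDyer.Rank1Residual.X11b.Three


end
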